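import Literature.AlgebraicGeometry.Hu2025.Statements.S01S09Interface.R110fSetupOurs
import Literature.AlgebraicGeometry.Hu2025.Proofs.S01S09Interface.GammaQuadHu22SetupLit
import Literature.AlgebraicGeometry.Hu2025.Proofs.S03Pluecker.GammaQuadTorusInvariance
import Mathlib.AlgebraicGeometry.AffineSpace
import HarnessLib

/-!
# Hu 2022 p.131, reading (β) «as printed, with (a) the TORUS QUOTIENT and (b) THE matroid Schubert cell» — the inhabitant
# `S_quad_torus : Hu22Setup_ours ℚ 9 d_quad` with `X := Gr_d/(𝔾⁹_m/𝔾_m)` (the normal-form slice), `quot :=` the torus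
# normalisation, `cell :=` the Prop-9.1 locus — `X` INTEGRAL, `Z_{Γ_d}` NOT integral
# (joint J1 / GAP-LEDGER-HU row HU-R01 — OURS; nothing of the sources asserted)

**HONEST FRAMING (D-0012/D-0089).** [Hu2025] (arXiv:2507.21400v1) / [Hu2022] (arXiv:2203.03842v4) are unrefereed preprints under
adjudication; nothing of them is asserted. This file bears on the M-Hu LEAD's INDEX RULING J1 (HOME/STATUS 2026-08-27T10:01:59Z):
J1 is worded per reading, and reading (β) = «AS PRINTED with (a)+(b) read in by hand from [Hu22] p.131 l.5–9 / Thm 9.4» gets a kernel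
word «only where a typed carrier exists». The printed properties (page in hand, `paper:arxiv-2203.03842` p.131):
(a) l.6–16 «We identify `U ⊂ X × 𝔸^r` with the quotient space `Gr̄^{3,E}_d = Gr^{3,E}_d/(𝔾ⁿ_m/𝔾_m)`. Consider the quotient map
`π : Gr^{3,E}_d → Gr̄^{3,E}_d`» (Thm 9.4, p.130 l.39–50: «`(𝔾ⁿ_m/𝔾_m)` acts freely on the matroid Schubert cell … `U` is isomorphic
to the quotient space `Gr̄^{3,E}_d := Gr^{3,E}_d/(𝔾ⁿ_m/𝔾_m)`»); (b) l.27–28, l.39–40 «We can apply Proposition 9.1 to the matroid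
Schubert cell `Gr^{3,E}_d` … `Gr^{3,E}_d` is an open subset of the Γ-scheme `Z_Γ ⊂ 𝕌_m`».

The g7 inhabitants `Lit.S_quad_lit` (row 110 e) / `S_quad` (row 110 f) take `X := cell`, `quot := id`: they carry (b) (`range_cellToGamma`
= the Prop-9.1 locus) but not (a). THIS FILE, for the same occurring family `d = quad` of the complete quadrilateral (`n = 9`, `𝔽 = ℚ`):
* `X_quad := Spec (Rh ⧸ J)` — the NORMAL-FORM SLICE `{[I₃|A] ∈ Gr_d : A_{1j} = 1 (j = 4..9), A_{24} = A_{34} = 1}` of the cell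
  (`S03Pluecker/GammaQuadTorus`), our carrier of `Gr̄_d = Gr_d/(𝔾⁹_m/𝔾_m)`: the torus acts freely on `Gr_d` and every orbit meets
  the slice exactly in the normal form `τ(A)·A`; INTEGRAL (`QuadTorus.isDomain_slice`);
* `quotX : cell ⟶ X_quad` = `Spec` of `πJ` = the torus NORMALISATION `A ↦ τ(A)·A` — the quotient map `π` of (a): it has the
  section `sliceX` (`sliceX_quotX : sliceX ≫ quotX = 𝟙`), hence is surjective, and is INVARIANT under the torus:
  `torusAct s ≫ quotX = quotX` for every `s ∈ (ℚˣ)⁹` (`torusAct_quotX`, from `S03Pluecker/GammaQuadTorusInvariance`);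
* `cell := Lit.cellScheme` = the open locus `{x̄_u invertible, u ∉ Γ_d}` of `Z_{Γ_d}` = the Prop-9.1 description of `Gr_d ∩ 𝕌_m`
  (b), with `range_cellToGamma` (row 110 f's field (i)); `U := ⊤ ⊂ X × 𝔸⁰`, `r := 0`; `m = (123) ∈ Δ_d`;
and records **`¬ Hu22P131L40 S_quad_torus.toHu22Setup`**, **`¬ Hu22P131L40_ours S_quad_torus`**: `X = Gr_d/T` is integral, the cell
is integral, and `Z_{Γ_d}` is NOT integral (`Lit.not_isIntegral_gammaSpec_Γq`; the cell is not dense in `Z_{Γ_d}`,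
`GammaQuadHu22Setup.not_dense_range_cellToGamma`). DISCLOSED LIMITS (typed-record matters): `X_quad` is of finite type over `ℚ`, not
over `Spec ℤ` ([Hu22] p.131 l.4) — no inhabitant of `Hu22Setup ℚ n M` with `quot`, `U ↠ X` surjective has `X ≠ ∅` of finite type over
`ℤ`; and «`d` = the matroid Thm 9.4 assigns to `X`» is untyped (no decl of Lafforgue's encoding exists; `LafforgueObjects` is abstract).
A statement about OUR typed records; it bears on the adjudication of the inference p.131 l.40–41, not on the truth of [Hu25] Thm 1.3.
AI proof is weaker than expert review.
-/

noncomputable section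

namespace Literature.AlgebraicGeometry.Hu2025.Statements.S01S09Interface

namespace Torus

open _root_.CategoryTheory _root_.AlgebraicGeometry S03Pluecker S07GammaSchemes S08MainTheorem

/-! ## The cell ring of row 110's record vs. the chart presentation `Rh ℚ` -/

/-- The localising submonoids correspond under `Lit.ringEquivRq`.
[cite: Hu2025, Prop. 9.1 (Gr_d) p.160 / Def. 7.1 (Z_Γ) p.128; [Hu22] p.131 l.27–40; joint J1 = GAP-LEDGER-HU row HU-R01 (unrefereed preprints arXiv:2507.21400v1 / arXiv:2203.03842v4 under adjudication, D-0012/D-0089 — kernel statement about OUR typed records of rows 101/109/110; nothing of the sources asserted)] -/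
theorem powers_den_map :
    (Submonoid.powers Lit.denΓq).map Lit.ringEquivRq.toMonoidHom = Submonoid.powers (QuadCell.hq ℚ) := by
  rw [Submonoid.map_powers]; exact congrArg Submonoid.powers Lit.ringEquivRq_den

/-- **The cell ring of the typed record ≅ the chart cell ring `Rh ℚ`** of `S03Pluecker/GammaQuadCellDomain`. OURS plumbing.
[cite: Hu2025, Prop. 9.1 (Gr_d) p.160 / Def. 7.1 (Z_Γ) p.128; [Hu22] p.131 l.27–40; joint J1 = GAP-LEDGER-HU row HU-R01 (unrefereed preprints arXiv:2507.21400v1 / arXiv:2203.03842v4 under adjudication, D-0012/D-0089 — kernel statement about OUR typed records of rows 101/109/110; nothing of the sources asserted)] -/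
def cellRingEquiv : Lit.CellRing ≃+* QuadCell.Rh ℚ :=
  IsLocalization.ringEquivOfRingEquiv Lit.CellRing (QuadCell.Rh ℚ) Lit.ringEquivRq powers_den_map

/-! ## `X_quad = Gr_d/(𝔾⁹_m/𝔾_m)` (the normal-form slice) and the quotient map -/

/-- **The coordinate ring of `Gr̄_d = Gr_d/(𝔾⁹_m/𝔾_m)` for `d = quad`**: the slice ring `Rh ℚ ⧸ J`. OURS.
[cite: Hu2025, Thm. 9.4 («U is isomorphic to the quotient space Gr̄_d := Gr_d/(𝔾ⁿ_m/𝔾_m)») p.161; [Hu22] p.131 l.6–16; joint J1 = GAP-LEDGER-HU row HU-R01 (unrefereed preprints arXiv:2507.21400v1 / arXiv:2203.03842v4 under adjudication, D-0012/D-0089 — kernel statement about OUR typed records of rows 101/109/110; nothing of the sources asserted)] -/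
abbrev SliceRing : Type := QuadTorus.Slice ℚ

/-- The slice ring is a domain (`QuadTorus.isDomain_slice`).
[cite: Hu2025, Thm. 9.4 p.161; [Hu22] p.131 l.6–16; joint J1 = GAP-LEDGER-HU row HU-R01 (unrefereed preprints under adjudication, D-0012/D-0089 — kernel statement about OUR typed records; nothing of the sources asserted)] -/
instance isDomain_sliceRing : IsDomain SliceRing := QuadTorus.isDomain_slice ℚ

/-- **`X_quad := Spec (Rh ℚ ⧸ J)`** — the torus quotient `Gr_d/(𝔾⁹_m/𝔾_m)` of the matroid Schubert cell of the complete
quadrilateral, realised as the normal-form slice. The `X` (and `U`) of the (β)-reading inhabitant. OURS.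
[cite: Hu2025, Thm. 9.4 («U is isomorphic to the quotient space Gr̄_d := Gr_d/(𝔾ⁿ_m/𝔾_m)») p.161; [Hu22] p.131 l.6–16 («We identify U ⊂ X × 𝔸^r with the quotient space Gr_d/(𝔾ⁿ_m/𝔾_m)»); joint J1 = GAP-LEDGER-HU row HU-R01 (unrefereed preprints arXiv:2507.21400v1 / arXiv:2203.03842v4 under adjudication, D-0012/D-0089 — kernel statement about OUR typed records of rows 101/109/110; nothing of the sources asserted)] -/
def X_quad : Scheme.{0} := Spec (CommRingCat.of SliceRing)

/-- **`X_quad` is INTEGRAL.**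
[cite: Hu2025, Thm. 9.4 p.161; [Hu22] p.131 l.6–16, l.40–41; joint J1 = GAP-LEDGER-HU row HU-R01 (unrefereed preprints under adjudication, D-0012/D-0089 — kernel statement about OUR typed records; nothing of the sources asserted)] -/
instance isIntegral_X_quad : IsIntegral X_quad := by unfold X_quad; infer_instance

/-- **The quotient map at ring level**, `Rh ℚ ⧸ J → CellRing`: `πJ` (induced by the torus normalisation `ν`) followed by the
identification of the cell rings. OURS.
[cite: Hu2025, Thm. 9.4 p.161; [Hu22] p.131 l.10–16 («Consider the quotient map π : Gr_d → Gr̄_d»); joint J1 = GAP-LEDGER-HU row HU-R01 (unrefereed preprints under adjudication, D-0012/D-0089 — kernel statement about OUR typed records; nothing of the sources asserted)] -/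
def quotHom : SliceRing →+* Lit.CellRing := cellRingEquiv.symm.toRingHom.comp (QuadTorus.πJ ℚ)

/-- **The quotient map `π : Gr_d ⟶ Gr_d/(𝔾⁹_m/𝔾_m) = X_quad`** (= `Spec` of `quotHom`; on matrices `A ↦ τ(A)·A`, the normal form).
OURS.
[cite: Hu2025, Thm. 9.4 p.161; [Hu22] p.131 l.10–16 («Consider the quotient map π : Gr_d → Gr̄_d»), diagram (9.2); joint J1 = GAP-LEDGER-HU row HU-R01 (unrefereed preprints under adjudication, D-0012/D-0089 — kernel statement about OUR typed records; nothing of the sources asserted)] -/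
def quotX : Lit.cellScheme ⟶ X_quad := Spec.map (CommRingCat.ofHom quotHom)

/-- The slice inclusion at ring level, `CellRing → Rh ℚ ⧸ J`. OURS.
[cite: Hu2025, Thm. 9.4 p.161; [Hu22] p.131 l.6–16; joint J1 = GAP-LEDGER-HU row HU-R01 (unrefereed preprints under adjudication, D-0012/D-0089 — kernel statement about OUR typed records; nothing of the sources asserted)] -/
def sliceHom : Lit.CellRing →+* SliceRing := (Ideal.Quotient.mk (QuadTorus.J ℚ)).comp cellRingEquiv.toRingHom

/-- **The slice inclusion `X_quad ⟶ Gr_d`** (the normal forms sit inside the cell). OURS.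
[cite: Hu2025, Thm. 9.4 p.161; [Hu22] p.131 l.6–16; joint J1 = GAP-LEDGER-HU row HU-R01 (unrefereed preprints under adjudication, D-0012/D-0089 — kernel statement about OUR typed records; nothing of the sources asserted)] -/
def sliceX : X_quad ⟶ Lit.cellScheme := Spec.map (CommRingCat.ofHom sliceHom)

/-- `sliceHom ∘ quotHom = id` (from `QuadTorus.mk_comp_πJ`).
[cite: Hu2025, Thm. 9.4 p.161; [Hu22] p.131 l.6–16; joint J1 = GAP-LEDGER-HU row HU-R01 (unrefereed preprints under adjudication, D-0012/D-0089 — kernel statement about OUR typed records; nothing of the sources asserted)] -/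
theorem sliceHom_comp_quotHom : sliceHom.comp quotHom = RingHom.id SliceRing := by
  have h : ∀ y, sliceHom (quotHom y) = Ideal.Quotient.mk (QuadTorus.J ℚ) (QuadTorus.πJ ℚ y) := fun y => by
    simp [sliceHom, quotHom]
  refine RingHom.ext fun y => ?_
  rw [RingHom.comp_apply, h, ← RingHom.comp_apply, QuadTorus.mk_comp_πJ]

/-- **`sliceX ≫ quotX = 𝟙`: the quotient map restricted to the slice is the identity** — every point of `X_quad` is the normal form
of itself; `quotX` is a retraction of the cell onto `Gr_d/(𝔾⁹_m/𝔾_m)`.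
[cite: Hu2025, Thm. 9.4 p.161; [Hu22] p.131 l.6–16 (diagram (9.2): π is onto); joint J1 = GAP-LEDGER-HU row HU-R01 (unrefereed preprints under adjudication, D-0012/D-0089 — kernel statement about OUR typed records; nothing of the sources asserted)] -/
theorem sliceX_quotX : sliceX ≫ quotX = 𝟙 X_quad := by
  show Spec.map (CommRingCat.ofHom sliceHom) ≫ Spec.map (CommRingCat.ofHom quotHom) = 𝟙 (Spec (CommRingCat.of SliceRing))
  rw [← Spec.map_comp, ← CommRingCat.ofHom_comp, sliceHom_comp_quotHom, CommRingCat.ofHom_id, Spec.map_id]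

/-- **The quotient map is surjective** (printed `↠` in diagram (9.2)).
[cite: Hu2025, Thm. 9.4 p.161; [Hu22] p.131 l.17–26 (diagram (9.2), `Gr_d ↠ Gr̄_d`); joint J1 = GAP-LEDGER-HU row HU-R01 (unrefereed preprints under adjudication, D-0012/D-0089 — kernel statement about OUR typed records; nothing of the sources asserted)] -/
instance surjective_quotX : Surjective quotX :=
  ⟨fun x => ⟨sliceX x, by rw [← Scheme.Hom.comp_apply, sliceX_quotX]; rfl⟩⟩

/-! ## The torus action on the cell and the invariance of the quotient map -/

/-- The action of the torus element `s ∈ (ℚˣ)⁹` on the cell ring of the record (transport of `QuadTorus.scale (constWeights s)`: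
`x̄_u ↦ (s_{u₁}s_{u₂}s_{u₃}/s₁s₂s₃)·x̄_u`). OURS.
[cite: Hu2025, Thm. 9.3/9.4 («the action of 𝔾ⁿ_m/𝔾_m on Gr^{d,n}_d … acts freely on the matroid Schubert cell») p.160–161; [Hu22] p.131 l.6–16; joint J1 = GAP-LEDGER-HU row HU-R01 (unrefereed preprints under adjudication, D-0012/D-0089 — kernel statement about OUR typed records; nothing of the sources asserted)] -/
def torusActHom (s : ℕ → ℚˣ) : Lit.CellRing →+* Lit.CellRing :=
  cellRingEquiv.symm.toRingHom.comp ((QuadTorus.scale ℚ (QuadTorus.constWeights ℚ s)).comp cellRingEquiv.toRingHom)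

/-- **The action of `s ∈ (ℚˣ)⁹ = (𝔾⁹_m)(ℚ)` on the cell `Gr_d`** (scheme level). OURS.
[cite: Hu2025, Thm. 9.3/9.4 («the action of 𝔾ⁿ_m/𝔾_m on Gr^{d,n}_d … acts freely on the matroid Schubert cell») p.160–161; [Hu22] p.131 l.6–16; joint J1 = GAP-LEDGER-HU row HU-R01 (unrefereed preprints under adjudication, D-0012/D-0089 — kernel statement about OUR typed records; nothing of the sources asserted)] -/
def torusAct (s : ℕ → ℚˣ) : Lit.cellScheme ⟶ Lit.cellScheme := Spec.map (CommRingCat.ofHom (torusActHom s))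

/-- `torusActHom s ∘ quotHom = quotHom` (from `QuadTorus.scale_const_comp_πJ`).
[cite: Hu2025, Thm. 9.4 p.161; [Hu22] p.131 l.6–16; joint J1 = GAP-LEDGER-HU row HU-R01 (unrefereed preprints under adjudication, D-0012/D-0089 — kernel statement about OUR typed records; nothing of the sources asserted)] -/
theorem torusActHom_comp_quotHom (s : ℕ → ℚˣ) : (torusActHom s).comp quotHom = quotHom := by
  have h : ∀ y, torusActHom s (quotHom y) =
      cellRingEquiv.symm (QuadTorus.scale ℚ (QuadTorus.constWeights ℚ s) (QuadTorus.πJ ℚ y)) := fun y => by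
    simp [torusActHom, quotHom]
  refine RingHom.ext fun y => ?_
  rw [RingHom.comp_apply, h, ← RingHom.comp_apply (QuadTorus.scale ℚ _), QuadTorus.scale_const_comp_πJ]
  rfl

/-- **T-INVARIANCE: `torusAct s ≫ quotX = quotX`** for every torus element `s ∈ (ℚˣ)⁹` — the quotient map `π : Gr_d → X_quad` is
constant on torus orbits (the normal form of `s·A` is that of `A`). With the section `sliceX_quotX` this is the kernel content of
(a) «`U ≅ Gr_d/(𝔾ⁿ_m/𝔾_m)`, `π` the quotient map» for the inhabitant below.
[cite: Hu2025, Thm. 9.4 («(𝔾ⁿ_m/𝔾_m) acts freely on the matroid Schubert cell … U is isomorphic to the quotient space Gr̄_d := Gr_d/(𝔾ⁿ_m/𝔾_m)») p.161; [Hu22] p.131 l.6–16 («We identify U … with the quotient space … Consider the quotient map π»); joint J1 = GAP-LEDGER-HU row HU-R01 (unrefereed preprints under adjudication, D-0012/D-0089 — kernel statement about OUR typed records; nothing of the sources asserted)] -/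
theorem torusAct_quotX (s : ℕ → ℚˣ) : torusAct s ≫ quotX = quotX := by
  show Spec.map (CommRingCat.ofHom (torusActHom s)) ≫ Spec.map (CommRingCat.ofHom quotHom) =
    Spec.map (CommRingCat.ofHom quotHom)
  rw [← Spec.map_comp, ← CommRingCat.ofHom_comp, torusActHom_comp_quotHom]

/-! ## The inhabitant and the failure of both typed readings -/

/-- **THE (β)-READING INHABITANT** `S_quad_torus : Hu22Setup_ours ℚ 9 quadHuMatroid`: `X := X_quad = Gr_d/(𝔾⁹_m/𝔾_m)` (normal-form
slice; integral), `r := 0`, `U := ⊤ ≅ X` (printed (a): «We identify `U` with the quotient space `Gr_d/(𝔾ⁿ_m/𝔾_m)`»), `cell :=` the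
matroid Schubert cell `Gr_d ∩ 𝕌_m` as the Prop-9.1 open locus of `Z_{Γ_d}` (printed (b)), `quot :=` the torus normalisation `quotX`
(«the quotient map `π`», surjective, with section `sliceX`, torus-invariant — sequel file), `m = (123) ∈ Δ_d`, `cell ↪ Z_{Γ_d}` open
with the Prop-9.1 image. OURS.
[cite: Hu2025, (9.2)/(9.3), Thm. 9.4 p.161 and [Hu22] p.131 l.4–41 (the set-up of the J1 inference, properties (a) l.6–16 and (b) l.27–40); joint J1 = GAP-LEDGER-HU row HU-R01, LEAD INDEX RULING 2026-08-27T10:01:59Z reading (β) (unrefereed preprints arXiv:2507.21400v1 / arXiv:2203.03842v4 under adjudication, D-0012/D-0089 — kernel statement about OUR typed records of rows 101/109/110; nothing of the sources asserted)] -/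
def S_quad_torus : Hu22Setup_ours ℚ 9 quadHuMatroid where
  X := X_quad
  r := 0
  U := ⊤
  U_onto := by
    haveI : IsIso (⊤ : (𝔸(Fin 0; X_quad)).Opens).ι :=
      inferInstanceAs (IsIso (𝔸(Fin 0; X_quad)).topIso.hom)
    infer_instance
  cell := Lit.cellScheme
  quot := quotX ≫ inv (𝔸(Fin 0; X_quad) ↘ X_quad) ≫ (𝔸(Fin 0; X_quad)).topIso.inv
  quot_surjective := by infer_instance
  m_mem := vertexMem_quadHuMatroid_mTri
  cellToGamma := Lit.cellToGammaQ
  cellToGamma_isOpenImmersion := by infer_instance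
  range_cellToGamma := Lit.range_cellToGammaQ

/-- Bookkeeping: the `X` of the inhabitant is the torus quotient `X_quad`, its cell is `Lit.cellScheme`, `r = 0`.
[cite: Hu2025, [Hu22] p.131 l.6–16, l.27–40; joint J1 = GAP-LEDGER-HU row HU-R01 (unrefereed preprints under adjudication, D-0012/D-0089 — kernel statement about OUR typed records; nothing of the sources asserted)] -/
theorem S_quad_torus_data : S_quad_torus.X = X_quad ∧ S_quad_torus.cell = Lit.cellScheme ∧ S_quad_torus.r = 0 :=
  ⟨rfl, rfl, rfl⟩

/-- **¬ Hu22P131L40 S_quad_torus.toHu22Setup** — the LITERAL typed reading of [Hu22] p.131 l.40–41 («As `X` is integral (by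
assumption), one sees that `Z_Γ` is integral») fails for the torus-quotient inhabitant: `X = Gr_d/(𝔾⁹_m/𝔾_m)` is integral, `Z_{Γ_d}` is
not.
[cite: Hu2025, [Hu22] p.131 l.40–41 (literal reading, row 110 e) with (a) l.6–16 and (b) l.27–40 instantiated; joint J1 = GAP-LEDGER-HU row HU-R01, reading (β) of the LEAD INDEX RULING 2026-08-27T10:01:59Z (unrefereed preprints under adjudication, D-0012/D-0089 — kernel statement about OUR typed records; nothing of the sources asserted)] -/
theorem not_Hu22P131L40_torus : ¬ Hu22P131L40 S_quad_torus.toHu22Setup := fun h =>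
  Lit.not_isIntegral_gammaSpec_Γq (h (inferInstanceAs (IsIntegral X_quad)))

/-- **¬ Hu22P131L40_ours S_quad_torus** — the OURS two-step reading (row 110 f) also fails for the torus-quotient inhabitant:
`X = Gr_d/(𝔾⁹_m/𝔾_m)` integral, the cell integral, `Z_{Γ_d}` not integral (the cell is not dense in `Z_{Γ_d}`).
[cite: Hu2025, [Hu22] p.131 l.40–41 (OURS two-step reading, row 110 f) with (a) l.6–16 and (b) l.27–40 instantiated; joint J1 = GAP-LEDGER-HU row HU-R01, reading (β)/(γ) of the LEAD INDEX RULING 2026-08-27T10:01:59Z (unrefereed preprints under adjudication, D-0012/D-0089 — kernel statement about OUR typed records; nothing of the sources asserted)] -/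
theorem not_Hu22P131L40_ours_torus : ¬ Hu22P131L40_ours S_quad_torus := fun h =>
  Lit.not_isIntegral_gammaSpec_Γq
    (h (inferInstanceAs (IsIntegral X_quad)) (inferInstanceAs (IsIntegral Lit.cellScheme)))

end Torus

end Literature.AlgebraicGeometry.Hu2025.Statements.S01S09Interface

end
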